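import Mathlib
import Summits.Ventures.PercRepro2.Defs
import Summits.Ventures.PercRepro2.Graph
import Summits.Ventures.PercRepro2.Events
import Summits.Ventures.PercRepro2.Harris
import Summits.Ventures.PercRepro2.PinnedLaw
import Summits.Ventures.PercRepro2.XWForm
import Summits.Ventures.PercRepro2.XWRelabel
import Summits.Ventures.PercRepro2.XWKTwoFourTab
import Summits.Ventures.PercRepro2.XWKTwoFourSub

/-!
# (XW) on the complete bipartite graph `K_{2,4}` for every weight vector and every placement of
the four marks on the leaves (PercRepro2, p2 g25)

**`xw_k24`**: `0 ≤ xwBil k24 (leaf s) (leaf y) (leaf o) (leaf u) p p` for every admissible weight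
vector on the eight edges of `K_{2,4}` (leaves `0..3`, hubs `4, 5`) and every placement of four
distinct marks on the leaves — (XW) on a 2-connected graph on SIX vertices, the two-hub member
`H₂` of the hub family (every non-mark adjacent to the marks only), beyond the reach
`≤ 5 vertices` of the certificate method for ALL graphs (P2-G24-XWGEN.md §8: the coefficientwise
statement fails on the 9-edge witness `H₀`, which has a hub–hub edge; on `K_{2,4}` every
colouring sum is nonnegative).  Assembly: the decided certificate `sums_all` (XWKTwoFourSub.lean)
gives every antipodal coefficient at the placement `0, 1, 2, 3`, hence (XW) there by
`xw_of_xwbern` through the bridges at point masses (`xw_k24_base`, as in XWKFour.lean /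
XWKFive.lean); the `S₄` relabelling of the leaves (`xwBil_relabel`, XWRelabel.lean) along
`permOf s y o u` and its edge permutation `sigmaOf` (bijectivity and compatibility decided for
the `24` placements) spreads it to every placement.  Own work; standard axioms.
-/

namespace Summit.Ventures.PercRepro2

namespace XWKTwoFour

/-! ## Bridges from the ring-valued forms to the integer forms -/

section Bridge

variable {R : Type*} [CommRing R] [Nontrivial R]

/-- The probability of an event under a pinned weight vector is the indicator of the forced
configuration, written through a Boolean. -/
lemma prob_pinned_eq_indZ {p : Fin 8 → R} (hp : Pinned.IsPinned p) (A : Set (Config (Fin 8)))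
    (b : Bool) (hb : Pinned.pinnedConfig p ∈ A ↔ b = true) :
    prob p A = ((indZ b : ℤ) : R) := by
  classical
  rw [Pinned.prob_eq_indicator_of_pinned hp, Set.indicator_apply]
  cases b
  · rw [if_neg (fun h => by simpa using hb.1 h)]
    simp [indZ]
  · rw [if_pos (hb.2 rfl)]
    simp [indZ]

/-- Membership in an intersection of two connection events, as a Boolean. -/
lemma mem_inter2_iff (ω : Config (Fin 8)) (a b c d : Fin 6) :
    ω ∈ connEvent k24 a b ∩ connEvent k24 c d ↔ (connB ω a b && connB ω c d) = true := by
  simp only [Set.mem_inter_iff, mem_connEvent_iff, Bool.and_eq_true]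

/-- Membership in an intersection of three connection events, as a Boolean. -/
lemma mem_inter3_iff (ω : Config (Fin 8)) (a b c d e f : Fin 6) :
    ω ∈ connEvent k24 a b ∩ connEvent k24 c d ∩ connEvent k24 e f ↔
      (connB ω a b && connB ω c d && connB ω e f) = true := by
  simp only [Set.mem_inter_iff, mem_connEvent_iff, Bool.and_eq_true]

/-- **`B_W` at two pinned weight vectors is the integer form at the forced configurations.** -/
lemma xwBil_pinned_eq {p q : Fin 8 → R} (hp : Pinned.IsPinned p) (hq : Pinned.IsPinned q)
    (s y o u : Fin 6) :
    xwBil k24 s y o u p q =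
      ((xwZ s y o u (Pinned.pinnedConfig p) (Pinned.pinnedConfig q) : ℤ) : R) := by
  unfold xwBil xwZ
  rw [prob_pinned_eq_indZ hp _ _ (mem_inter2_iff _ s u y o),
    prob_pinned_eq_indZ hp _ _ (mem_inter2_iff _ s y s u),
    prob_pinned_eq_indZ hq _ _ (mem_inter2_iff _ s y y o),
    prob_pinned_eq_indZ hp _ _ (mem_connEvent_iff _ s u),
    prob_pinned_eq_indZ hq _ _ (mem_connEvent_iff _ y o),
    prob_pinned_eq_indZ hp _ _ (mem_connEvent_iff _ s y),
    prob_pinned_eq_indZ hq _ _ (mem_inter3_iff _ s y s u y o)]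
  push_cast
  ring

/-- Pinning on `F` keeps a pinned vector pinned. -/
lemma isPinned_pinOn {p : Fin 8 → R} (hp : Pinned.IsPinned p) (F : Finset (Fin 8))
    (η : Config (Fin 8)) : Pinned.IsPinned (pinOn p F η) := by
  intro e
  by_cases he : e ∈ F
  · cases η e <;> simp [pinOn, he]
  · simp only [pinOn, he, if_false]
    exact hp e

/-- The forced configuration of `pinOn p F η` is `pinnedConfig p` overwritten by `η` on `F`. -/
lemma pinnedConfig_pinOn {p : Fin 8 → R} (F : Finset (Fin 8)) (η : Config (Fin 8)) :
    Pinned.pinnedConfig (pinOn p F η) = mix (Pinned.pinnedConfig p) F η := by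
  funext e
  by_cases he : e ∈ F
  · cases hη : η e <;> simp [Pinned.pinnedConfig, pinOn, mix, he, hη]
  · simp [Pinned.pinnedConfig, pinOn, mix, he]

end Bridge

section BridgeOrdered

variable {R : Type*} [CommRing R] [LinearOrder R] [IsStrictOrderedRing R]

/-- **The antipodal coefficient at a pinned weight vector is the integer antipodal sum.** -/
lemma xwAnti_pinned_eq {p : Fin 8 → R} (hp : Pinned.IsPinned p) (s y o u : Fin 6)
    (F : Finset (Fin 8)) :
    xwAnti k24 s y o u p F = ((xwAntiZ s y o u (Pinned.pinnedConfig p) F : ℤ) : R) := by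
  unfold xwAnti xwAntiZ
  push_cast
  refine Finset.sum_congr rfl fun η _ => ?_
  rw [xwBil_pinned_eq (isPinned_pinOn hp F η) (isPinned_pinOn hp F _), pinnedConfig_pinOn,
    pinnedConfig_pinOn]

/-- **(XW) on `K_{2,4}` at the placement `0, 1, 2, 3`** (the decided certificate through the pin
induction `xw_of_xwbern`). -/
theorem xw_k24_base (p : Fin 8 → R) (hp : IsProbVec p) : 0 ≤ xwBil k24 0 1 2 3 p p := by
  refine xw_of_xwbern k24 0 1 2 3 ?_ p hp
  intro q _ hpin F
  rw [xwAnti_pinned_eq hpin]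
  exact_mod_cast xwAntiZ_nonneg (Pinned.pinnedConfig q) F

end BridgeOrdered

/-! ## Every placement of the marks on the leaves by the `S₄` relabelling -/

/-- The leaves of `K_{2,4}` as vertices. -/
def leaf (i : Fin 4) : Fin 6 := ⟨i.val, by omega⟩

/-- The vertex map sending the leaves `0, 1, 2, 3` to the marks and fixing the hubs. -/
def permOf (s y o u : Fin 4) : Fin 6 → Fin 6 := ![leaf s, leaf y, leaf o, leaf u, 4, 5]

/-- The leaf endpoint of each edge. -/
def ea : Fin 8 → Fin 6 := ![0, 0, 1, 1, 2, 2, 3, 3]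

/-- The hub endpoint of each edge. -/
def eb : Fin 8 → Fin 6 := ![4, 5, 4, 5, 4, 5, 4, 5]

/-- The edge permutation induced by a vertex map. -/
def sigmaOf (φ : Fin 6 → Fin 6) : Fin 8 → Fin 8 :=
  fun e => ⟨edgeIdx (φ (ea e)) (φ (eb e)) % 8, Nat.mod_lt _ (by norm_num)⟩

/-- For four distinct marks on the leaves the vertex map is a bijection. -/
lemma permOf_bij : ∀ s y o u : Fin 4, s ≠ y → s ≠ o → s ≠ u → y ≠ o → y ≠ u → o ≠ u →
    Function.Bijective (permOf s y o u) := by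
  decide +kernel

/-- For four distinct marks on the leaves the induced edge map is a bijection. -/
lemma sigmaOf_bij : ∀ s y o u : Fin 4, s ≠ y → s ≠ o → s ≠ u → y ≠ o → y ≠ u → o ≠ u →
    Function.Bijective (sigmaOf (permOf s y o u)) := by
  decide +kernel

/-- The induced edge map is compatible with the vertex map on `k24`. -/
lemma sigmaOf_comp : ∀ s y o u : Fin 4, s ≠ y → s ≠ o → s ≠ u → y ≠ o → y ≠ u → o ≠ u →
    ∀ e, k24 (sigmaOf (permOf s y o u) e) = Sym2.map (permOf s y o u) (k24 e) := by
  decide +kernel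

section Main

variable {R : Type*} [CommRing R] [LinearOrder R] [IsStrictOrderedRing R]

/-- **(XW) on `K_{2,4}` for every admissible weight vector and every placement of the four
distinct marks on the leaves** (the degree-two side): the first 2-connected graph on six
vertices in the kernel, the two-hub member of the hub family. -/
theorem xw_k24 (p : Fin 8 → R) (hp : IsProbVec p) (s y o u : Fin 4) (hsy : s ≠ y)
    (hso : s ≠ o) (hsu : s ≠ u) (hyo : y ≠ o) (hyu : y ≠ u) (hou : o ≠ u) :
    0 ≤ xwBil k24 (leaf s) (leaf y) (leaf o) (leaf u) p p := by
  let φe : Fin 6 ≃ Fin 6 := Equiv.ofBijective _ (permOf_bij s y o u hsy hso hsu hyo hyu hou)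
  let σe : Fin 8 ≃ Fin 8 :=
    Equiv.ofBijective _ (sigmaOf_bij s y o u hsy hso hsu hyo hyu hou)
  have hcomp : ∀ e, k24 (σe e) = Sym2.map φe (k24 e) :=
    sigmaOf_comp s y o u hsy hso hsu hyo hyu hou
  have h := XWRelabel.xwBil_relabel (ends := k24) σe φe hcomp p 0 1 2 3
  have h0 : φe 0 = leaf s := rfl
  have h1 : φe 1 = leaf y := rfl
  have h2 : φe 2 = leaf o := rfl
  have h3 : φe 3 = leaf u := rfl
  rw [h0, h1, h2, h3] at h
  rw [h]
  exact xw_k24_base (p ∘ σe) (XWRelabel.isProbVec_comp hp σe)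

end Main

end XWKTwoFour

end Summit.Ventures.PercRepro2
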